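import Summits.Ventures.Crystal3D.Theorems.StickyWulffConstantTextureLiminfTexShadowCoverageBarlowDefs
import HarnessLib

/-!
# TexShadow row (e), K3 with CHOSEN SLOTS: the one-sided coverage certificate over the full family menu {canonical, UP_v, DOWN_v}
# (lane T, crux `TextureLiminfV5`, stmt-Ventures-23912; cf-p1 g31 (ci) / «chosen slots next» of HOME/wall-p2-g11/EDGE-ON-MEMO.md R1; K3-ENGINE-SPEC §2)

HONEST FRAMING. Venture `Summits/Ventures/Crystal3D` (cell `crystal3d-full`), route `route-Ventures-StickyWulffConstant`, helper
`--supports` the law-v5 crux `TextureLiminfV5` (stmt-Ventures-23912), registered line `TexShadow` (v8.2/v8.3), stub `stub_residualFaultedCore`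
resp. `stub_coverageBarlow`.  DEFINITIONS ONLY (+ one inclusion); no certificate is asserted; rung F-C1 not moved.

THE POINT.  `…TexShadowCoverageBarlowDefs` (p694269) types the K3 per-box verdict for the CANONICAL family of each plate
(`BarlowOneSidedCertified`).  Where the canonical forced ray READS the passive plate (clause (i) fails), lane G's chosen-slot K1a
(`barlow_hlines_oriented_oneSided_at` p692347 / `…_top_at` p692835) with wulff-p2's glue (`bilayerWallAt_of_K1a_at` p693671 / `…_top_at` p694292)
prices the pair from ANOTHER reference up-slot `v` whose chain frames are apart — at the price that Δ-bilayers deliver only `√2·⟪L v, e₃⟫`.  This file: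
* **`BarlowUpCertifiedAt c₀ σ₁ L₁ L₂ v`** — `v` a reference up-slot (`v ∈ fccSlots`, `v₂ = √(2/3)`) of plate 1's up-presentation, STEEP (`⟪upFrame L₁ e₃ v, e₃⟫ ≥ √2/2`) and
  RISING `≥ √2·c₀`, every bilayer of plate 1 rising `≥ √2·c₀` (`bilayerRise`; only the ∇-bilayers' capper rise is new information), and clause (i) for the forced chain frames
  `chainFrames e₃ (upFrame L₁ e₃) v`; **`BarlowDownCertifiedAt c₀ σ₂ L₁ L₂ v`** — the mirror statement (plate 2 toward `−e₃`, clause (ii));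
* **`BarlowMenuCertified c₀ σ₁ σ₂ L₁ L₂`** := canonical (`BarlowOneSidedCertified`) ∨ `∃ v, Up v` ∨ `∃ v, Down v` — the engine's per-box verdict over the FULL `±e₃`-steered menu
  (K3-ENGINE-SPEC §2: UP_v/DOWN_v, three slots each);
* **`ResidualMenuCoverageBarlowOn Reg c₀`** (schema) and the candidate instance **`ResidualMenuCoverageBarlow c₀`** (`Reg := ¬EdgeOnAt c₀`) — WEAKER than the canonical-only
  `ResidualOneSidedCoverageBarlow c₀` (`menuCoverageBarlowOn_of_coverageBarlowOn`), hence easier to certify; the glue (next file) lands it on the same `BilayerWallFaultedOnAt Reg`.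
WHAT THIS IS NOT: no certificate; general steering `z ≠ e₃` (K1b / EDGE-ON-MEMO option (ε)) is NOT in this menu; F-C1 not moved.
-/

noncomputable section

open scoped BigOperators InnerProductSpace ENNReal
open MeasureTheory Filter

namespace Summit.Ventures.Crystal3D.Cruxes.TextureLiminf.TexShadow

open Summit.Ventures.Crystal3D Summit.Ventures.Crystal3D.Theorems
open Literature.MathematicalPhysics.StatisticalMechanics (IsHaggSeq fccStacking barlowStacking basalMirror)

/-! ## Chosen-slot family certificates -/

/-- **UP family of plate 1 with the CHOSEN reference up-slot `v`, certified at charge `c₀`** (= the hypotheses `hv hv2 hsteep₁ hapart₁` of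
`barlow_hlines_oriented_oneSided_at` for the up-presentation `upFrame L₁ e₃`, plus test (γ): the slot rises `≥ √2·c₀` and every bilayer rises `≥ √2·c₀`). -/
def BarlowUpCertifiedAt (c₀ : ℝ) (σ₁ : ℤ → ℤ) (L₁ L₂ : E3 ≃ₗᵢ[ℝ] E3) (v : E3) : Prop :=
  v ∈ fccSlots ∧ v 2 = Real.sqrt (2 / 3) ∧
    Real.sqrt 2 / 2 ≤ ⟪upFrame L₁ e₃ v, e₃⟫_ℝ ∧ Real.sqrt 2 * c₀ ≤ ⟪upFrame L₁ e₃ v, e₃⟫_ℝ ∧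
    (∀ i : ℤ, Real.sqrt 2 * c₀ ≤ bilayerRise L₁ σ₁ e₃ i) ∧
    ∀ F ∈ chainFrames e₃ (upFrame L₁ e₃) v,
      F '' fccStacking 1 (Real.sqrt (2 / 3)) ≠ L₂ '' fccStacking 1 (Real.sqrt (2 / 3)) ∧
      F '' fccStacking 1 (Real.sqrt (2 / 3)) ≠ (twinFrame L₂ (L₂ e₃)) '' fccStacking 1 (Real.sqrt (2 / 3))

/-- **DOWN family of plate 2 with the CHOSEN reference up-slot `v`, certified at charge `c₀`** (plate 2 toward `−e₃`; `barlow_hlines_oriented_oneSided_top_at`). -/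
def BarlowDownCertifiedAt (c₀ : ℝ) (σ₂ : ℤ → ℤ) (L₁ L₂ : E3 ≃ₗᵢ[ℝ] E3) (v : E3) : Prop :=
  v ∈ fccSlots ∧ v 2 = Real.sqrt (2 / 3) ∧
    Real.sqrt 2 / 2 ≤ ⟪upFrame L₂ (-e₃) v, -e₃⟫_ℝ ∧ Real.sqrt 2 * c₀ ≤ ⟪upFrame L₂ (-e₃) v, -e₃⟫_ℝ ∧
    (∀ j : ℤ, Real.sqrt 2 * c₀ ≤ bilayerRise L₂ σ₂ (-e₃) j) ∧
    ∀ F ∈ chainFrames (-e₃) (upFrame L₂ (-e₃)) v,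
      F '' fccStacking 1 (Real.sqrt (2 / 3)) ≠ L₁ '' fccStacking 1 (Real.sqrt (2 / 3)) ∧
      F '' fccStacking 1 (Real.sqrt (2 / 3)) ≠ (twinFrame L₁ (L₁ e₃)) '' fccStacking 1 (Real.sqrt (2 / 3))

/-- **Certified over the full `±e₃`-steered family MENU**: the canonical verdict, or some chosen UP slot of plate 1, or some chosen DOWN slot of plate 2. -/
def BarlowMenuCertified (c₀ : ℝ) (σ₁ σ₂ : ℤ → ℤ) (L₁ L₂ : E3 ≃ₗᵢ[ℝ] E3) : Prop :=
  BarlowOneSidedCertified c₀ σ₁ σ₂ L₁ L₂ ∨ (∃ v : E3, BarlowUpCertifiedAt c₀ σ₁ L₁ L₂ v) ∨ (∃ v : E3, BarlowDownCertifiedAt c₀ σ₂ L₁ L₂ v)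

/-! ## The menu certificate: schema and candidate instance -/

/-- **THE ONE-SIDED BARLOW COVERAGE CERTIFICATE ON `Reg`, FULL MENU** (schema): every faulted Hägg pair of presented plates in `Reg` is menu-certified at `c₀`. -/
def ResidualMenuCoverageBarlowOn (Reg : (ℤ → ℤ) → (ℤ → ℤ) → (E3 ≃ₗᵢ[ℝ] E3) → (E3 ≃ₗᵢ[ℝ] E3) → Prop) (c₀ : ℝ) : Prop :=
  ∀ (σ₁ σ₂ : ℤ → ℤ), IsHaggSeq σ₁ → IsHaggSeq σ₂ → ¬ BothFcc σ₁ σ₂ →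
    ∀ (L₁ L₂ : E3 ≃ₗᵢ[ℝ] E3), Reg σ₁ σ₂ L₁ L₂ → BarlowMenuCertified c₀ σ₁ σ₂ L₁ L₂

/-- **`ResidualMenuCoverageBarlow c₀`** — the candidate named fact of row (e) over the full menu (NOT asserted): outside the edge-on regime some family of the
menu is certified.  Weaker than `ResidualOneSidedCoverageBarlow c₀`. -/
def ResidualMenuCoverageBarlow (c₀ : ℝ) : Prop :=
  ResidualMenuCoverageBarlowOn (fun σ₁ σ₂ L₁ L₂ => ¬ EdgeOnAt c₀ σ₁ σ₂ L₁ L₂) c₀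

/-! ## Inclusions -/

/-- A canonical-only certificate is a menu certificate. -/
theorem menuCoverageBarlowOn_of_coverageBarlowOn {Reg : (ℤ → ℤ) → (ℤ → ℤ) → (E3 ≃ₗᵢ[ℝ] E3) → (E3 ≃ₗᵢ[ℝ] E3) → Prop} {c₀ : ℝ}
    (h : ResidualOneSidedCoverageBarlowOn Reg c₀) : ResidualMenuCoverageBarlowOn Reg c₀ :=
  fun σ₁ σ₂ hσ₁ hσ₂ hf L₁ L₂ hreg => Or.inl (h σ₁ σ₂ hσ₁ hσ₂ hf L₁ L₂ hreg)

/-- The candidate canonical fact gives the candidate menu fact. -/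
theorem menuCoverageBarlow_of_coverageBarlow {c₀ : ℝ} (h : ResidualOneSidedCoverageBarlow c₀) : ResidualMenuCoverageBarlow c₀ :=
  menuCoverageBarlowOn_of_coverageBarlowOn h

/-- Menu certificates restrict along implications of regimes. -/
theorem menuCoverageBarlowOn_mono {Reg Reg' : (ℤ → ℤ) → (ℤ → ℤ) → (E3 ≃ₗᵢ[ℝ] E3) → (E3 ≃ₗᵢ[ℝ] E3) → Prop}
    (hle : ∀ σ₁ σ₂ L₁ L₂, Reg' σ₁ σ₂ L₁ L₂ → Reg σ₁ σ₂ L₁ L₂) {c₀ : ℝ} (h : ResidualMenuCoverageBarlowOn Reg c₀) :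
    ResidualMenuCoverageBarlowOn Reg' c₀ :=
  fun σ₁ σ₂ hσ₁ hσ₂ hf L₁ L₂ hreg => h σ₁ σ₂ hσ₁ hσ₂ hf L₁ L₂ (hle σ₁ σ₂ L₁ L₂ hreg)

end Summit.Ventures.Crystal3D.Cruxes.TextureLiminf.TexShadow

end
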